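import Literature.AnabelianGeometry.AbsoluteAnabelian.ArchimedeanLogFrobeniusModel
import Mathlib.CategoryTheory.Discrete.Basic
import HarnessLib

/-!
# [AbsTopIII] Def 4.1 (i)/(v) — NON-VACUITY of `AutHolFieldFunctor` and `LinHolObj`
# (rows «NV-L4/AutHolFieldFunctor», «NV-L4/LinHolObj»)

Mochizuki, *Topics in Absolute Anabelian Geometry III*, Def 4.1 (i) p. 101 (the functor `EA ∋ 𝕏 ↦ 𝒜_𝕏 ∪ {0}`, a
CAF, "by Corollary 2.7 (e)") and Def 4.1 (v) p. 105 (the category `LinHol` of pairs `(𝕏 ↶ 𝒜_𝕏)`); typed by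
abc-iut-L4-t14 / L4-t12 in `ArchimedeanHolCategories.lean` (`AutHolFieldFunctor`) and
`ArchimedeanLogFrobeniusModel.lean` (`LinHolObj 𝔄`). PROOF-ONLY companion (no `def`, no `instance`, no
`structure`). abc-iut-w5-d197's INHABITATION CENSUS L4 v1 (§A) lists both with ZERO producers. This file records:

* `LinHolObj.nonempty_iff` — GENERIC and EXACT: for EVERY `𝔄 : AutHolFieldFunctor`, `LinHolObj 𝔄` is inhabited
  iff `EA` has an object (the tautological pair `(𝕏 ↶ 𝒜_𝕏)` = abc-iut-L4-t12's landed functor `HolTFPair.ofEA`);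
  `LinHolObj.exists_of_obj` names the witness over a given `𝕏`;
* `AutHolFieldFunctor.exists_complex` — a witness whose ARITHMETIC half is GENUINE (`𝒜 := ℂ`, a CAF by the
  tree's `isCAF_complex`; `Amap := RingEquiv.refl`, bicontinuous, functorial) over a DEGENERATE index category
  `EA := Discrete PUnit` (ONE object, identities only). HONEST LABEL: this is NOT the category of elliptically
  admissible Aut-holomorphic orbispaces with finite étale morphisms — inhabiting THAT `EA` with the reconstructed
  `𝒜_𝕏` is [AbsTopIII] Cor 2.7 (e) at a model (L4 SUBDAG Cor-27), not available as a closed term tonight;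
* `LinHolObj.nonempty_degenerate` — hence `LinHolObj` is inhabited over that degenerate functor (closed term).

Nothing of [AbsTopIII] is asserted; a witness is consistency evidence only.
[cite: MochizukiAbsTopIII2015, Definition 4.1 (i) p.101]
-/

noncomputable section

namespace Literature.AnabelianGeometry.AbsoluteAnabelian

open CategoryTheory

universe u

/-- **AbsTopIII:Def4.1(v)** (kurims p.105) GENERIC, EXACT: for every `𝔄`, the objects of `LinHol` exist iff `EA` has
an object — the pair `(𝕏 ↶ 𝒜_𝕏)` "which IS the tautological one" (abc-iut-L4-t12's `HolTFPair.ofEA`).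
[cite: MochizukiAbsTopIII2015, Definition 4.1 (v) p.105] -/
theorem LinHolObj.nonempty_iff (𝔄 : AutHolFieldFunctor.{u}) : Nonempty (LinHolObj 𝔄) ↔ Nonempty 𝔄.EA :=
  ⟨fun ⟨P⟩ => ⟨P.X⟩, fun ⟨X⟩ => ⟨⟨X, (HolTFPair.ofEA 𝔄).obj X, rfl⟩⟩⟩

/-- **AbsTopIII:Def4.1(v)** (kurims p.105) The `LinHol`-object over a given structure-orbispace `𝕏 ∈ Ob(EA)`.
[cite: MochizukiAbsTopIII2015, Definition 4.1 (v) p.105] -/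
theorem LinHolObj.exists_of_obj (𝔄 : AutHolFieldFunctor.{u}) (X : 𝔄.EA) : ∃ P : LinHolObj 𝔄, P.X = X :=
  ⟨⟨X, (HolTFPair.ofEA 𝔄).obj X, rfl⟩, rfl⟩

/-- **AbsTopIII:Def4.1(i)** (kurims p.101) A witness of the functor record with GENUINE arithmetic half and DEGENERATE
index category: `EA := Discrete PUnit` (one object, identity morphisms only), `𝒜 := ℂ` (a CAF: the tree's
`isCAF_complex`), `Amap := RingEquiv.refl ℂ` (bicontinuous; identities and composition hold on the nose). NOT the
category of elliptically admissible Aut-holomorphic orbispaces (see the module docstring).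
[cite: MochizukiAbsTopIII2015, Definition 4.1 (i) p.101] -/
theorem AutHolFieldFunctor.exists_complex :
    ∃ 𝔄 : AutHolFieldFunctor.{0}, 𝔄.EA = Discrete PUnit.{2} ∧ (∀ X, 𝔄.A X = ℂ) ∧ Nonempty 𝔄.EA :=
  ⟨{ EA := Discrete PUnit.{2}
     A := fun _ => ℂ
     isCAF := fun _ => isCAF_complex
     Amap := fun _ => RingEquiv.refl ℂ
     continuous_Amap := fun _ => continuous_id
     continuous_Amap_symm := fun _ => continuous_id
     Amap_id := fun _ => rfl
     Amap_comp := fun _ _ => rfl },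
    rfl, fun _ => rfl, ⟨⟨PUnit.unit⟩⟩⟩

/-- **AbsTopIII:Def4.1(i)** (kurims p.101) The interface `AutHolFieldFunctor` is inhabited (closed term, degenerate
index category / genuine CAF `ℂ`). [cite: MochizukiAbsTopIII2015, Definition 4.1 (i) p.101] -/
theorem AutHolFieldFunctor.nonempty_degenerate : Nonempty AutHolFieldFunctor.{0} :=
  let ⟨𝔄, _⟩ := AutHolFieldFunctor.exists_complex; ⟨𝔄⟩

/-- **AbsTopIII:Def4.1(v)** (kurims p.105) … hence `LinHolObj` is inhabited on a closed term (over the degenerate functor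
with `𝒜 = ℂ`). [cite: MochizukiAbsTopIII2015, Definition 4.1 (v) p.105] -/
theorem LinHolObj.nonempty_degenerate : ∃ 𝔄 : AutHolFieldFunctor.{0}, (∀ X, 𝔄.A X = ℂ) ∧ Nonempty (LinHolObj 𝔄) := by
  obtain ⟨𝔄, -, hA, hne⟩ := AutHolFieldFunctor.exists_complex
  exact ⟨𝔄, hA, (LinHolObj.nonempty_iff 𝔄).2 hne⟩

end Literature.AnabelianGeometry.AbsoluteAnabelian

end
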